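import Literature.MathematicalPhysics.QuantumFieldTheory.Balaban1983to89.B2Sect3AReplacement587
import Literature.MathematicalPhysics.QuantumFieldTheory.Balaban1983to89.B2Ineq2103LogDet

/-!
# `Balaban1983to89.B2Sect3AStep39Final` — [Balaban1982Higgs2] §3.A pp. 585–587 ASSEMBLED: the (3.9)-integral of one field is
`≦` the same integral with `H′_k = 0`, `F′_k = 0` times `exp O((Lᵏε)^κ)|Λ₅⁽ᵏ⁾|`, from the printed inputs (3.10), (3.11),
(3.12), (3.16) ALONE — the determinant half (3.18)–(3.20) is now DISCHARGED by p04's `…B2Ineq2103LogDet.ineq318_320`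
(theorems only; the knitting of this seat's `…B2Sect3AReplacement587.replacement587` with p04's file)

statement-level skeleton of published theorems with citation tags; proofs where landed; nothing here is a claim about the Yang–Mills mass gap

CITATION HEADER.  T. Bałaban, *(Higgs)₂,₃ quantum fields in a finite volume. II. An upper bound*, Commun. Math. Phys.
**86** (1982) 555–594 [Balaban1982Higgs2] (cell paper B2; PDF held `paper:balaban1982-cmp86-higgs23-ii`, journal page =
PDF page + 554; pp. 585–587 READ AS IMAGES on the ×2 renders `…/1982-cmp86-higgs23-II-p031…p033-x2.png`).  Unit
`lit-balaban-p15` gen 2 (Phase-2 proof seat p15; HOME `run/shared/lean/pub/lit-balaban/`).  SKELETON row **B2.Eq3.20**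
((3.13)–(3.20) and the p. 587 continuation).  INPUT FILES, consumed BY NAME, nothing restated: this seat's
`…B2Sect3AGaussianStep` ((3.9) = (3.17), p. 586 positivity, `exists_scale_threshold`) and `…B2Sect3AReplacement587`
(`replacement587`: the sentence with the determinant bound as hypothesis `η`), p04's `…B2Ineq2103LogDet.ineq318_320`
((3.18)–(3.20): `[det(G′ − H′)]^{−1/2} ≦ (det G′)^{−1/2}exp((h/g)|ι|)` in Loewner form), r14's `B2StepK.rDecayBeatsPowers`
((2.109)/(3.12) «for every κ»).  Fold owners r02 / r14, §3 second reader r13, referee ref-4.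

WHAT IS PRINTED (verbatim, p. 587 [PDF 33]): *"Thus the integral (3.9) can be estimated by the same integral with
H′_k = H″_k = 0, F′_k = F″_k = 0 and multiplied by the factor exp O((Lᵏε)^κ)|Λ₅⁽ᵏ⁾|."* — with, p. 586: *"Hence for Lᵏε
sufficiently small, the operators G′_k − H′_k and G″_k − H″_k are positive …"*, (3.11) `G′_k ≧ γ₁μ₀²(Lᵏε)²I`, (3.12)
`‖H′_k‖ ≦ O(1)exp(−δ₁r(Lᵏε))`, (3.10) `|F′_k(x)| ≦ O(1)exp(−δ₁r(Lᵏε))`, (3.16) `|Φ′(x)| ≦ O(1)(Lᵏε)⁻²`.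

THE MODEL = the siblings' (schematic coordinates; see `…B2Sect3AGaussianStep`): one field `A : ι → ℝ`, `G′_k = QᵀCQ + Δ`,
`w₀ = Qᵀ(c·E) − DᵀAext + f` (↤ `Φ′ − Λ₅Δ(Λ₅′∩Λ₅ᶜ)A_k + f′_k`), `H` ↤ `H′_k`, `F` ↤ `F′_k`; «‖H′_k‖ ≦ h» in numerical-radius
form.  WHAT THIS MODULE PROVES (kernel-checked, 0 `sorry`, standard axioms; THEOREMS ONLY): the Loewner dictionaries
`posSemidef_sub_smul_one_of_form` (`G ≧ gI` from the form bound), `posSemidef_sandwich_of_form` (`−hI ≦ H ≦ hI` from the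
numerical radius), `ratio312_311_le_pow` (`h/g = C_He^{−δ₁r(ℓ)}/(γℓ²) ≦ C_κℓ^κ`), and **`step39_bound`**: for every κ there
are `ℓ₀ > 0`, `C_κ ≥ 0` (depending on δ₁, R, r, γ, C_H, C_W, C_F, κ only — not on k, the volume or the operators) such that
for `0 < ℓ = Lᵏε ≦ ℓ₀` and all data satisfying (3.10), (3.11), (3.12), (3.16):
`∫dA e^{(3.9)-exponent} ≦ (∫dA e^{(3.9)-exponent, H = 0, F = 0}) · exp(C_κℓ^κ|ι|)`.
HONEST SCOPE: as in the siblings — the operators and functions of (3.9) are matrices/vectors (not constructed), the four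
printed estimates are hypotheses, `|ι|` = sites × components; one field (the φ-field factor is the same statement).
-/

noncomputable section

open MeasureTheory Matrix Finset Real
open scoped BigOperators Matrix MatrixOrder

namespace Literature.MathematicalPhysics.QuantumFieldTheory.Balaban1983to89.B2Sect3AStep39Final

open B2Sect3AGaussianStep B2Sect3AReplacement587

/-! ## §1 Loewner dictionaries for the form hypotheses -/

section Loewner

variable {ι : Type*} [Fintype ι] [DecidableEq ι]

/-- `G ≧ gI` in Loewner form from the quadratic-form bound (symmetric `G`). [folklore] [cite: Balaban1982Higgs2, (3.11) p.585] -/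
theorem posSemidef_sub_smul_one_of_form {G : Matrix ι ι ℝ} (hG : G.IsSymm) {g : ℝ}
    (h : ∀ u, g * (u ⬝ᵥ u) ≤ u ⬝ᵥ (G *ᵥ u)) : (G - g • (1 : Matrix ι ι ℝ)).PosSemidef := by
  refine PosSemidef.of_dotProduct_mulVec_nonneg ?_ fun u => ?_
  · rw [IsHermitian, conjTranspose_eq_transpose_of_trivial, transpose_sub, transpose_smul, transpose_one, hG.eq]
  · have := h u
    simp only [star_trivial, sub_mulVec, smul_mulVec, one_mulVec, dotProduct_sub, dotProduct_smul, smul_eq_mul]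
    linarith

/-- `−hI ≦ H ≦ hI` in Loewner form from the numerical-radius bound `|⟨u,Hu⟩| ≦ h‖u‖²` (symmetric `H`).
[folklore] [cite: Balaban1982Higgs2, (3.12) p.586] -/
theorem posSemidef_sandwich_of_form {H : Matrix ι ι ℝ} (hH : H.IsSymm) {h : ℝ}
    (hf : ∀ u, |u ⬝ᵥ (H *ᵥ u)| ≤ h * (u ⬝ᵥ u)) :
    (h • (1 : Matrix ι ι ℝ) - H).PosSemidef ∧ (H + h • (1 : Matrix ι ι ℝ)).PosSemidef := by
  have hHh : H.IsHermitian := by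
    rw [IsHermitian, conjTranspose_eq_transpose_of_trivial]; exact hH.eq
  have h1h : (h • (1 : Matrix ι ι ℝ)).IsHermitian := by
    rw [IsHermitian, conjTranspose_eq_transpose_of_trivial, transpose_smul, transpose_one]
  constructor
  · refine PosSemidef.of_dotProduct_mulVec_nonneg (h1h.sub hHh) fun u => ?_
    have := (abs_le.mp (hf u)).2
    simp only [star_trivial, sub_mulVec, smul_mulVec, one_mulVec, dotProduct_sub, dotProduct_smul, smul_eq_mul]
    linarith
  · refine PosSemidef.of_dotProduct_mulVec_nonneg (hHh.add h1h) fun u => ?_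
    have := (abs_le.mp (hf u)).1
    simp only [star_trivial, add_mulVec, smul_mulVec, one_mulVec, dotProduct_add, dotProduct_smul, smul_eq_mul]
    linarith

end Loewner

/-! ## §2 The ratio `h/g` of (3.12)/(3.11) is `O((Lᵏε)^κ)` -/

/-- `h/g = C_He^{−δ₁r(ℓ)}/(γℓ²) ≦ C_κℓ^κ` on `(0,1]` for every κ (r14's `rDecayBeatsPowers` at κ + 2) — the exponent `η|ι|`
of p04's determinant bound `ineq318_320` is `O((Lᵏε)^κ)|ι|`. [cite: Balaban1982Higgs2, (3.19)–(3.20) p.587] -/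
theorem ratio312_311_le_pow {δ₁ R r γ CH : ℝ} (hδ : 0 < δ₁) (hR : 0 < R) (hr : 1 < r) (hγ : 0 < γ) (hCH : 0 ≤ CH)
    (κ : ℝ) : ∃ C : ℝ, 0 ≤ C ∧ ∀ ℓ : ℝ, 0 < ℓ → ℓ ≤ 1 →
      CH * Real.exp (-(δ₁ * B2.rFn R r ℓ)) / (γ * ℓ ^ 2) ≤ C * ℓ ^ κ := by
  obtain ⟨C2, hC2⟩ := B2StepK.rDecayBeatsPowers hδ hR hr (κ + 2)
  have hC2pos : 0 < C2 := by
    have h := hC2 1 one_pos le_rfl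
    rw [Real.one_rpow, mul_one] at h
    exact (Real.exp_pos _).trans_le h
  refine ⟨CH * C2 / γ, by positivity, fun ℓ hℓ hℓ1 => ?_⟩
  have h := hC2 ℓ hℓ hℓ1
  rw [div_le_iff₀ (by positivity)]
  calc CH * Real.exp (-(δ₁ * B2.rFn R r ℓ)) ≤ CH * (C2 * ℓ ^ (κ + 2)) := mul_le_mul_of_nonneg_left h hCH
    _ = CH * C2 / γ * ℓ ^ κ * (γ * ℓ ^ 2) := by
        rw [Real.rpow_add hℓ, show ((2 : ℝ)) = ((2 : ℕ) : ℝ) by norm_num, Real.rpow_natCast]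
        field_simp

/-! ## §3 The assembled estimate of the (3.9)-integral -/

/-- **p. 587, assembled** (one field; the φ-field factor is the same statement): *"Thus the integral (3.9) can be estimated
by the same integral with H′_k = H″_k = 0, F′_k = F″_k = 0 and multiplied by the factor exp O((Lᵏε)^κ)|Λ₅⁽ᵏ⁾|."* —
for the printed ranges δ₁, R > 0, r > 1, the (3.11)-constant γ > 0 (↤ γ₁μ₀²) and O(1)'s `C_H, C_W, C_F ≥ 0` of (3.12), (3.16),
(3.10), and every κ: there are `ℓ₀ > 0` and `C_κ ≥ 0` such that for `0 < ℓ = Lᵏε ≦ ℓ₀`, all finite index types and all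
data with `Δ`, `H` symmetric, (3.11) `G′ = QᵀCQ + Δ ≧ γℓ²I`, (3.12) `|⟨u,Hu⟩| ≦ C_He^{−δ₁r(ℓ)}‖u‖²`, (3.16)+restrictions
`|w₀(x)| ≦ C_Wℓ⁻²`, (3.10) `|F(x)| ≦ C_Fe^{−δ₁r(ℓ)}`:
`∫dA e^{(3.9)-exponent} ≦ (∫dA e^{(3.9)-exponent with H = 0, F = 0}) · exp(C_κℓ^κ|ι|)`.  The determinant half is p04's
`B2Ineq2103LogDet.ineq318_320`, the exponent half this seat's `replacement587`.
[cite: Balaban1982Higgs2, p.587; (3.9)–(3.11) p.585; (3.12), (3.16) p.586; (3.18)–(3.20) pp.586–587] -/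
theorem step39_bound {δ₁ R r γ CH CW CF : ℝ} (hδ : 0 < δ₁) (hR : 0 < R) (hr : 1 < r) (hγ : 0 < γ) (hCH : 0 ≤ CH)
    (hCW : 0 ≤ CW) (hCF : 0 ≤ CF) (κ : ℝ) :
    ∃ ℓ₀ : ℝ, 0 < ℓ₀ ∧ ∃ Cκ : ℝ, 0 ≤ Cκ ∧ ∀ ℓ : ℝ, 0 < ℓ → ℓ ≤ ℓ₀ →
      ∀ {ι J ιE : Type} [Fintype ι] [Fintype J] [Fintype ιE] [DecidableEq ι] [DecidableEq J]
        (c E : J → ℝ) (Q : Matrix J ι ℝ) (Δ H : Matrix ι ι ℝ) (Aext : ιE → ℝ) (D : Matrix ιE ι ℝ)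
        (f F : ι → ℝ),
        Δ.IsSymm → H.IsSymm →
        (∀ u, γ * ℓ ^ 2 * (u ⬝ᵥ u) ≤ u ⬝ᵥ ((Qᵀ * (diagonal c * Q) + Δ) *ᵥ u)) →
        (∀ u, |u ⬝ᵥ (H *ᵥ u)| ≤ CH * Real.exp (-(δ₁ * B2.rFn R r ℓ)) * (u ⬝ᵥ u)) →
        (∀ x, |(Qᵀ *ᵥ (c * E) - Dᵀ *ᵥ Aext + f) x| ≤ CW / ℓ ^ 2) →
        (∀ x, |F x| ≤ CF * Real.exp (-(δ₁ * B2.rFn R r ℓ))) →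
        ∫ A : ι → ℝ, Real.exp (-(1 / 2 : ℝ) * ∑ j, c j * (E j - (Q *ᵥ A) j) ^ 2 - (1 / 2 : ℝ) * (A ⬝ᵥ (Δ *ᵥ A))
            - Aext ⬝ᵥ (D *ᵥ A) + f ⬝ᵥ A + (1 / 2 : ℝ) * (A ⬝ᵥ (H *ᵥ A)) + F ⬝ᵥ A)
          ≤ (∫ A : ι → ℝ, Real.exp (-(1 / 2 : ℝ) * ∑ j, c j * (E j - (Q *ᵥ A) j) ^ 2
                - (1 / 2 : ℝ) * (A ⬝ᵥ (Δ *ᵥ A)) - Aext ⬝ᵥ (D *ᵥ A) + f ⬝ᵥ A))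
            * Real.exp (Cκ * ℓ ^ κ * Fintype.card ι) := by
  obtain ⟨ℓ₁, hℓ₁, C₁, hC₁, h587⟩ := replacement587 hδ hR hr hγ hCH hCW hCF κ
  obtain ⟨ℓ₂, hℓ₂, hℓ₂1, hthr⟩ := exists_scale_threshold hδ hR hr hCH hγ
  obtain ⟨C₂, hC₂, hratio⟩ := ratio312_311_le_pow hδ hR hr hγ hCH κ
  refine ⟨min ℓ₁ ℓ₂, lt_min hℓ₁ hℓ₂, C₂ + C₁, by positivity, ?_⟩
  intro ℓ hℓ hℓm ι J ιE _ _ _ _ _ c E Q Δ H Aext D f F hΔ hHs hG hH hW hF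
  have hℓ1' : ℓ ≤ ℓ₁ := hℓm.trans (min_le_left _ _)
  have hℓ2' : ℓ ≤ ℓ₂ := hℓm.trans (min_le_right _ _)
  have hℓ1 : ℓ ≤ 1 := hℓ2'.trans hℓ₂1
  -- the scale-dependent constants g = γℓ², h = C_H e^{−δ₁r(ℓ)}
  set g : ℝ := γ * ℓ ^ 2 with hg
  set h : ℝ := CH * Real.exp (-(δ₁ * B2.rFn R r ℓ)) with hh
  have hg0 : 0 < g := by positivity
  have hh0 : 0 ≤ h := by positivity
  have hhg : h / g ≤ 1 / 2 := by
    rw [div_le_iff₀ hg0]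
    have := hthr ℓ hℓ hℓ2'
    rw [hh, hg]; linarith
  -- symmetry / positivity of G′ = QᵀCQ + Δ
  have hG0s : (Qᵀ * (diagonal c * Q) + Δ).IsSymm := by
    have h1 : (Qᵀ * (diagonal c * Q)).IsSymm := by
      show (Qᵀ * (diagonal c * Q))ᵀ = Qᵀ * (diagonal c * Q)
      rw [transpose_mul, transpose_mul, transpose_transpose, diagonal_transpose, Matrix.mul_assoc]
    exact h1.add hΔ
  have hPD0 : (Qᵀ * (diagonal c * Q) + Δ).PosDef := posDef_of_quadForm_lower hG0s hg0 hG
  have hHh : H.IsHermitian := by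
    rw [IsHermitian, conjTranspose_eq_transpose_of_trivial]; exact hHs.eq
  -- (3.18)–(3.20): p04's determinant bound, η = h/g
  have hdet := B2Ineq2103LogDet.ineq318_320 hPD0 hHh hg0 hh0 hhg (posSemidef_sub_smul_one_of_form hG0s hG)
    (posSemidef_sandwich_of_form hHs hH).1 (posSemidef_sandwich_of_form hHs hH).2
  -- the exponent half
  have hmain := h587 ℓ hℓ hℓ1' c E Q Δ H Aext D f F (h / g) hΔ hHs hG hH hW hF hdet
  refine hmain.trans ?_
  have hI : 0 ≤ ∫ A : ι → ℝ, Real.exp (-(1 / 2 : ℝ) * ∑ j, c j * (E j - (Q *ᵥ A) j) ^ 2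
      - (1 / 2 : ℝ) * (A ⬝ᵥ (Δ *ᵥ A)) - Aext ⬝ᵥ (D *ᵥ A) + f ⬝ᵥ A) :=
    integral_nonneg fun A => (Real.exp_pos _).le
  refine mul_le_mul_of_nonneg_left (Real.exp_le_exp.mpr ?_) hI
  have hn : 0 ≤ (Fintype.card ι : ℝ) := Nat.cast_nonneg _
  have hr' : h / g ≤ C₂ * ℓ ^ κ := by
    have := hratio ℓ hℓ hℓ1
    rwa [hh, hg]
  nlinarith [mul_le_mul_of_nonneg_right hr' hn]

end Literature.MathematicalPhysics.QuantumFieldTheory.Balaban1983to89.B2Sect3AStep39Final
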